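import Summits.PneNP.PneNP.Theorems.SmallBlockRothvossAccounting
import Summits.PneNP.PneNP.Theorems.SmallBlockRothvossFace
import Literature.Barriers.PneNP.TSPExtensionComplexityRothvossAssembly
import Literature.Combinatorics.Optimization.BlockPsdFactorization
import HarnessLib

/-!
# Cell pnp-psdrank, T-SOC (`SmallBlockRothvoss`): second-order-cone lifts of `P_PM(n)` have size `2^{Ω(n)}`

The bound in explicit form, over the tree vocabulary
`Literature.Combinatorics.Optimization.HasBlockPsdFactorization n b m` ("the odd-cut slack matrix
`|δ(U) ∩ M| − 1` of Edmonds' perfect matching polytope of `K_n` is a sum of `m` pairings of psd `b × b`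
blocks", i.e. `P_PM(n)` has an `(S^b_+)^m`-lift; `b = 2` = second-order-cone lifts):
`matchingSmallBlockPsdBound_explicit : ∃ α > 0, ∃ n₀, ∀ n ≥ n₀ even, ∀ m, HasBlockPsdFactorization n 2 m → 2^{α n} ≤ m`
with `α = δ_R / 6384` (`δ_R` = the tree's Rothvoß constant `Literature.Barriers.PneNP.δR`). Proof: face
restriction `P_PM(N) ↪ P_PM(n)` down to Rothvoß's slot size `N = |Slot m 72| = 216m + 150 ≤ n` (`m` odd, `n − N` even;
eng's `SmallBlockRothvossFace`, interchangeable with the tree's `HasBlockPsdFactorization.of_le`), the two-block bound `two_block_core` (file SmallBlockRothvossAccounting) on the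
`t`-cut rows, and exponential-versus-polynomial arithmetic (`leaf_arith`, `C0_le`, `sqrt_θR_mul_rpow`).
The cell's closed leaf `MatchingSmallBlockPsdBound` (planner p2, ROUND-4 §7) is literally this statement; its
by-name closer is filed separately once the leaf declaration is in the tree.
Source: pnp-psdrank-eng g3's farm-checked cumulative work file `HOME/pnp-psdrank-eng/lean/SocLift.lean`
(Part D, sha16 68f549726b9fc648; rc 0, 0 sorries, axioms standard), split per landing/README.md.
WHAT THIS IS NOT: not a psd-rank lower bound for general (unrestricted block size) psd lifts of the matching
polytope — the FGPRT open problem stays open; not approximation-robust (exact lifts only); nothing about P vs NP.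
-/

set_option linter.dupNamespace false -- `Summit.PneNP.PneNP.…`: summit = sub-problem (D-0017)

noncomputable section

open scoped Classical MatrixOrder

namespace Summit.PneNP.PneNP.Theorems.SmallBlockRothvoss

open Finset Matrix Real Literature.Barriers.PneNP Literature.Combinatorics.Optimization

/-! ### Arithmetic -/

/-- The final comparison: `y⁴ ≤ P ≤ r·Cn` and `Cn ≤ y³` force `y ≤ r`. -/
theorem leaf_arith {r y P Cn : ℝ} (hP : y ^ 4 ≤ P) (hPr : P ≤ r * Cn) (hy : Cn ≤ y ^ 3)
    (hy0 : 0 < y) (hCn : 0 < Cn) : y ≤ r := by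
  by_contra hlt
  push Not at hlt
  have h1 : r * Cn < y * Cn := mul_lt_mul_of_pos_right hlt hCn
  have h2 : y ^ 4 < y * Cn := lt_of_le_of_lt (hP.trans hPr) h1
  have h3 : y * Cn ≤ y * y ^ 3 := mul_le_mul_of_nonneg_left hy hy0.le
  have h4 : y * y ^ 3 = y ^ 4 := by ring
  linarith

/-- A numerical bound on the constant: `C0 ≤ 1183776` (from `π ≤ 4`). -/
theorem C0_le : C0 ≤ 1183776 := by
  unfold C0
  have hπ := Real.pi_le_four
  have hπ0 := Real.pi_pos.le
  nlinarith [mul_le_mul hπ hπ hπ0 (by norm_num : (0:ℝ) ≤ 4)]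

/-- `√(θ_R m) · 2^{δ_R m / 2} = 1`. -/
theorem sqrt_θR_mul_rpow (m : ℕ) : Real.sqrt (θR m) * (2 : ℝ) ^ (δR * m / 2) = 1 := by
  have hθ := θR_pos m
  have hP : 0 < (2 : ℝ) ^ (δR * m / 2) := Real.rpow_pos_of_pos (by norm_num) _
  have hsq : (Real.sqrt (θR m) * (2 : ℝ) ^ (δR * m / 2)) ^ 2 = 1 := by
    rw [mul_pow, Real.sq_sqrt hθ.le, ← Real.rpow_natCast ((2 : ℝ) ^ (δR * m / 2)) 2,
      ← Real.rpow_mul (by norm_num : (0 : ℝ) ≤ 2)]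
    have : δR * m / 2 * ((2 : ℕ) : ℝ) = δR * m := by push_cast; ring
    rw [this]
    exact θR_mul_rpow m
  have hpos : 0 < Real.sqrt (θR m) * (2 : ℝ) ^ (δR * m / 2) := mul_pos (Real.sqrt_pos.2 hθ) hP
  nlinarith [hsq, hpos]

/-! ### The bound -/

/-- **T-SOC: second-order-cone (`(S²₊)^m`) lifts of the perfect matching polytope have size `2^{Ω(n)}`**,
explicit form with `α = δ_R / 6384`: for all even `n ≥ n₀` and all `m`,
`HasBlockPsdFactorization n 2 m → 2^{α n} ≤ m`. Proof: face `P_PM(N) ↪ P_PM(n)` at Rothvoß's slot size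
`N = 216m+150 ≤ n`, the two-block bound `two_block_core`, and
exponential-versus-polynomial arithmetic. -/
theorem matchingSmallBlockPsdBound_explicit :
    ∃ α : ℝ, 0 < α ∧ ∃ n₀ : ℕ, ∀ n : ℕ, n₀ ≤ n → Even n → ∀ m : ℕ,
      HasBlockPsdFactorization n 2 m → (2 : ℝ) ^ (α * n) ≤ m := by
  have hδ := δR_pos
  set α : ℝ := δR / 6384 with hα
  have hαpos : 0 < α := by rw [hα]; positivity
  -- thresholds
  obtain ⟨n₁, hn₁⟩ : ∃ n₁ : ℕ, ∀ n ≥ n₁, 2 * (n : ℝ) ^ 2 ≤ (2 : ℝ) ^ (α * n - 0) :=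
    Filter.eventually_atTop.1 (eventually_two_mul_sq_le_two_rpow hαpos 0)
  set T : ℝ := max (798 * ((64 / cU εR) ^ 2)) (max (798 * (32 / cU εR))
    (798 * (16 * FQ * Real.log QB / cM qR εR))) with hT
  refine ⟨α, hαpos, max (max 1000 ⌈T⌉₊) n₁, fun n hn heven r hfac => ?_⟩
  have hn1000 : 1000 ≤ n := le_trans (le_max_left _ _) (le_trans (le_max_left _ _) hn)
  have hnT : T ≤ (n : ℝ) :=
    (Nat.le_ceil T).trans (by exact_mod_cast le_trans (le_max_right _ _) (le_trans (le_max_left _ _) hn))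
  have hnn₁ : n₁ ≤ n := le_trans (le_max_right _ _) hn
  have hT1 : 798 * ((64 / cU εR) ^ 2) ≤ (n : ℝ) := le_trans (le_max_left _ _) hnT
  have hT2 : 798 * (32 / cU εR) ≤ (n : ℝ) := le_trans (le_trans (le_max_left _ _) (le_max_right _ _)) hnT
  have hT3 : 798 * (16 * FQ * Real.log QB / cM qR εR) ≤ (n : ℝ) :=
    le_trans (le_trans (le_max_right _ _) (le_max_right _ _)) hnT
  -- the parameters
  set μ : ℕ := (n - 366) / 432 with hμ
  set m : ℕ := 2 * μ + 1 with hm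
  have hdiv : n - 366 < 432 * (μ + 1) := by
    have := Nat.lt_div_mul_add (a := n - 366) (b := 432) (by norm_num)
    rw [hμ]; linarith
  have hle : 432 * μ ≤ n - 366 := by rw [hμ]; exact Nat.mul_div_le _ _ |>.trans' (by rw [Nat.mul_comm])
  have hmn : n ≤ 798 * m := by omega
  have hmR : (n : ℝ) ≤ 798 * (m : ℝ) := by exact_mod_cast hmn
  have h798 : (0 : ℝ) < 798 := by norm_num
  -- the largeness hypotheses
  have hA1 : (64 / cU εR) ^ 2 ≤ (m : ℝ) := le_of_mul_le_mul_left (hT1.trans hmR) h798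
  have hA2 : 32 / cU εR ≤ (m : ℝ) := le_of_mul_le_mul_left (hT2.trans hmR) h798
  have hA3 : 16 * FQ * Real.log QB / cM qR εR ≤ (m : ℝ) := le_of_mul_le_mul_left (hT3.trans hmR) h798
  have hm1 : (m : ℝ) ≤ (m : ℝ) + 1 := by linarith
  -- the slot size
  set N : ℕ := Fintype.card (Slot m qR) with hNdef
  have hN' : N = 432 * μ + 366 := by rw [hNdef, Slot.card, hm]; unfold qR; ring
  have hNn : N ≤ n := by omega
  have hevenN : Even N := ⟨216 * μ + 183, by rw [hN']; ring⟩
  have hevenD : Even (n - N) := (Nat.even_sub hNn).2 ⟨fun _ => hevenN, fun _ => heven⟩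
  -- a perfect matching on the new vertices (face `P_PM(N) ↪ P_PM(n)`, eng's `SmallBlockRothvossFace`;
  -- interchangeable with the tree's `HasBlockPsdFactorization.of_le hfac hNn hevenD`, p415122)
  obtain ⟨M₀, hM₀⟩ := exists_isPMOn_of_even (n - N) (rest hNn) (card_rest hNn) hevenD
  -- the block factorization, restricted to the face
  obtain ⟨A, B, hA, hB, hslack⟩ := (show HasBlockPsdFactorization n 2 r from hfac)
  have ht : Odd (tCut qR μ) := by
    unfold tCut qR
    exact Even.add_odd (Even.mul_left (by decide) _) (by decide)
  have key := two_block_core μ hm (hA1.trans hm1) (hA2.trans hm1) hA3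
    (fun a i => B (a.1.map (emb hNn)) i) (fun b i => A (liftPM hNn M₀ b.1) i)
    (fun a i => hB _ i (by rw [card_map, a.2]; exact ht))
    (fun b i => hA _ i (liftPM_isPMOn hNn hM₀ b.2))
    (fun a b => by
      have h1 := hslack (a.1.map (emb hNn)) (liftPM hNn M₀ b.1) (by rw [card_map, a.2]; exact ht)
        (liftPM_isPMOn hNn hM₀ b.2)
      unfold pmSlack at h1
      rw [card_cut_liftPM hNn hM₀] at h1
      rw [h1]
      exact sum_congr rfl fun i _ => Matrix.trace_mul_comm _ _)
  -- `key : 1 ≤ r * (C0 * (t - 1)² * √θ)`; sizes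
  have htn : (tCut qR μ : ℝ) - 1 ≤ n := by
    have : tCut qR μ ≤ n := by unfold tCut qR; omega
    have : (tCut qR μ : ℝ) ≤ n := by exact_mod_cast this
    linarith
  have ht0 : (0 : ℝ) ≤ (tCut qR μ : ℝ) - 1 := by
    have : (1 : ℝ) ≤ tCut qR μ := by exact_mod_cast ht.pos
    linarith
  have hr0 : (0 : ℝ) ≤ r := Nat.cast_nonneg r
  have hs0 : 0 ≤ Real.sqrt (θR m) := Real.sqrt_nonneg _
  have hC0 := C0_pos
  have key2 : (1 : ℝ) ≤ r * (C0 * (n : ℝ) ^ 2 * Real.sqrt (θR m)) := by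
    have hsq : ((tCut qR μ : ℝ) - 1) ^ 2 ≤ (n : ℝ) ^ 2 := pow_le_pow_left₀ ht0 htn 2
    have : C0 * ((tCut qR μ : ℝ) - 1) ^ 2 * Real.sqrt (θR m) ≤ C0 * (n : ℝ) ^ 2 * Real.sqrt (θR m) :=
      mul_le_mul_of_nonneg_right (mul_le_mul_of_nonneg_left hsq hC0.le) hs0
    exact key.trans (mul_le_mul_of_nonneg_left this hr0)
  -- `P = 2^{δ m / 2} ≤ r · C0 · n²`
  set P : ℝ := (2 : ℝ) ^ (δR * m / 2) with hPdef
  have hP0 : 0 < P := Real.rpow_pos_of_pos (by norm_num) _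
  have hsP : Real.sqrt (θR m) * P = 1 := sqrt_θR_mul_rpow m
  have hPr : P ≤ r * (C0 * (n : ℝ) ^ 2) := by
    have := mul_le_mul_of_nonneg_right key2 hP0.le
    rw [one_mul] at this
    calc P ≤ r * (C0 * (n : ℝ) ^ 2 * Real.sqrt (θR m)) * P := this
      _ = r * (C0 * (n : ℝ) ^ 2) * (Real.sqrt (θR m) * P) := by ring
      _ = r * (C0 * (n : ℝ) ^ 2) := by rw [hsP, mul_one]
  -- `y = 2^{α n}`: `y⁴ ≤ P` and `C0 n² ≤ y³`
  set y : ℝ := (2 : ℝ) ^ (α * n) with hy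
  have hy0 : 0 < y := Real.rpow_pos_of_pos (by norm_num) _
  have hy4 : y ^ 4 ≤ P := by
    rw [hy, hPdef, ← Real.rpow_natCast, ← Real.rpow_mul (by norm_num)]
    apply Real.rpow_le_rpow_of_exponent_le (by norm_num)
    have h1 : α * n * ((4 : ℕ) : ℝ) = δR * ((n : ℝ) / 1596) := by rw [hα]; push_cast; ring
    rw [h1, mul_div_assoc]
    apply mul_le_mul_of_nonneg_left _ hδ.le
    rw [div_le_div_iff₀ (by norm_num) (by norm_num)]
    linarith
  have hy2 : 2 * (n : ℝ) ^ 2 ≤ y := by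
    have := hn₁ n hnn₁
    rwa [sub_zero] at this
  have hnR : (20 : ℝ) ≤ n := by exact_mod_cast (show 20 ≤ n by omega)
  have hCn : C0 * (n : ℝ) ^ 2 ≤ y ^ 3 := by
    have hn4 : (20 : ℝ) ^ 4 ≤ (n : ℝ) ^ 4 := pow_le_pow_left₀ (by norm_num) hnR 4
    have h8 : C0 ≤ 8 * (n : ℝ) ^ 4 := by
      have h20 : (20 : ℝ) ^ 4 = 160000 := by norm_num
      linarith [C0_le]
    have hy3 : (2 * (n : ℝ) ^ 2) ^ 3 ≤ y ^ 3 := pow_le_pow_left₀ (by positivity) hy2 3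
    have hn2 : (0 : ℝ) ≤ (n : ℝ) ^ 2 := sq_nonneg _
    calc C0 * (n : ℝ) ^ 2 ≤ (8 * (n : ℝ) ^ 4) * (n : ℝ) ^ 2 := mul_le_mul_of_nonneg_right h8 hn2
      _ = (2 * (n : ℝ) ^ 2) ^ 3 := by ring
      _ ≤ y ^ 3 := hy3
  have hCn0 : 0 < C0 * (n : ℝ) ^ 2 := by positivity
  -- conclude
  show (2 : ℝ) ^ (α * n) ≤ r
  exact leaf_arith hy4 hPr hCn hy0 hCn0

end Summit.PneNP.PneNP.Theorems.SmallBlockRothvoss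

end
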